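import Summits.ResolutionOfSingularities.ResolutionOfSingularities.Theorems.FrobeniusClosingSteerLowTowerDictionary
import Mathlib.RingTheory.LocalRing.RingHom.Basic
import HarnessLib

/-!
# D3a part 11: the image-quantified clause (T9) of `exists_lowTower` from its UPSTAIRS form
(res-D-pv-012 AS res-L0-w41-stub-8; W4.1 crux `Steer`, LOW branch, strat-2 §σ2.24; glue for the skeleton leaf `lowTowerExistsTwo_holds`.) OURS; AI.

`torsor_regular_image_of_upstairs`: if, UPSTAIRS in the regular local member `R`, the torsor `T² = f` is regular at every prime
`Q ≠ 𝔪_R` strictly above the critical ideal `𝔭 = (D₁ f, D₂ f)` with `R ⧸ Q` regular (σ_top at a point step: no permissible curve), then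
for EVERY surjection `ρ : R → S` onto a regular local ring with kernel `𝔭` and every prime `Q' ≠ ⊥, ≠ 𝔪_S` of `S` with `S ⧸ Q'`
regular, the surface torsor `T² = ρ f` is regular at `Q'` — the shape of the binder `hT9` of `LowTower.exists_lowTower`
(via `singAlong_of_surjective`).
-/

noncomputable section
set_option linter.dupNamespace false

namespace Summit.ResolutionOfSingularities.ResolutionOfSingularities.Theorems.SwitchingDichotomy.LowTower

open IsLocalRing Polynomial

universe u

/-- **(T9) image-quantified from upstairs.** [cite: Matsumura1987, Thm. 14.2] [folklore] -/
theorem torsor_regular_image_of_upstairs {R S : Type u} [CommRing R] [IsRegularLocalRing R] [CharP R 2] [CommRing S]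
    [IsRegularLocalRing S] [CharP S 2] (ρ : R →+* S) (hρ : Function.Surjective ρ) (f : R) (D₁ D₂ : Derivation ℤ R R)
    (hker : ∀ r : R, ρ r = 0 ↔ r ∈ Ideal.span {D₁ f, D₂ f})
    (hdet : IsUnit (D₁ (D₁ f) * D₂ (D₂ f) - D₁ (D₂ f) * D₂ (D₁ f)))
    (hup : ∀ (Q : Ideal R) [Q.IsPrime], Ideal.span {D₁ f, D₂ f} ≤ Q → Q ≠ Ideal.span {D₁ f, D₂ f} → Q ≠ maximalIdeal R →
      IsRegularLocalRing (R ⧸ Q) →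
      IsRegularLocalRing (AdjoinRoot ((X : (Localization.AtPrime Q)[X]) ^ 2 - C (algebraMap R (Localization.AtPrime Q) f))))
    (Q' : Ideal S) [Q'.IsPrime] (hQ'0 : Q' ≠ ⊥) (hQ'm : Q' ≠ maximalIdeal S) (hQ'reg : IsRegularLocalRing (S ⧸ Q')) :
    IsRegularLocalRing (AdjoinRoot ((X : (Localization.AtPrime Q')[X]) ^ 2 - C (algebraMap S (Localization.AtPrime Q') (ρ f)))) := by
  classical
  set Q : Ideal R := Q'.comap ρ with hQ
  haveI : Q.IsPrime := Ideal.comap_isPrime ρ Q'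
  -- `𝔭 ≤ Q`, `Q ≠ 𝔭`, `Q ≠ 𝔪_R`, `R ⧸ Q ≅ S ⧸ Q'` regular
  have hpQ : Ideal.span {D₁ f, D₂ f} ≤ Q := fun r hr => by
    rw [hQ, Ideal.mem_comap, (hker r).mpr hr]; exact Q'.zero_mem
  have hQp : Q ≠ Ideal.span {D₁ f, D₂ f} := by
    intro hQe
    apply hQ'0
    refine (Submodule.eq_bot_iff _).mpr fun y hy => ?_
    obtain ⟨r, rfl⟩ := hρ y
    have hrQ : r ∈ Q := hy
    rw [hQe] at hrQ
    exact (hker r).mpr hrQ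
  have hQm : Q ≠ maximalIdeal R := by
    intro hQe
    apply hQ'm
    have h1 : Q' = Q.map ρ := by rw [hQ, Ideal.map_comap_of_surjective _ hρ]
    rw [h1, hQe]
    exact map_maximalIdeal_of_surjective ρ hρ
  have hQreg : IsRegularLocalRing (R ⧸ Q) := by
    let π : R →+* S ⧸ Q' := (Ideal.Quotient.mk Q').comp ρ
    have hπs : Function.Surjective π := (Ideal.Quotient.mk_surjective).comp hρ
    have hkerπ : RingHom.ker π = Q := by
      ext r
      rw [RingHom.mem_ker, hQ, Ideal.mem_comap]
      exact Ideal.Quotient.eq_zero_iff_mem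
    haveI := hQ'reg
    exact IsRegularLocalRing.of_ringEquiv
      ((RingHom.quotientKerEquivOfSurjective hπs).symm.trans (Ideal.quotEquivOfEq hkerπ))
  have hupQ := hup Q hpQ hQp hQm hQreg
  by_contra hsing
  exact ((singAlong_of_surjective ρ hρ f D₁ D₂ hker hdet Q').mpr hsing) hupQ

end Summit.ResolutionOfSingularities.ResolutionOfSingularities.Theorems.SwitchingDichotomy.LowTower

end
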